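import Mathlib
import Summits.Langlands.Langlands.Theorems.PhantomRMYoshidaResiduallyYoshidaLiftingTraceLimit
import Literature.RepresentationTheory.Semisimple.Semisimplification
import Literature.RepresentationTheory.Semisimple.EquivOfCharacter
import Literature.RepresentationTheory.Semisimple.SubrepresentationEquiv

/-!
# Trace limits II — endoscopic traces, the Aut/Endo dichotomy and endo-removal modulo the limit
# lemma (route `PhantomRMYoshida`, crux `ResiduallyYoshidaLifting` = stmt-Langlands-13639, line
# `endoscopic-crossing-euler`, Stub 4)

Companion of `…TraceLimit.lean` (`--supports stmt-Langlands-13639`).  Stub 4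
`stub_weightTwoClassicality` of the line assumes `ρ : Γ_ℚ → GL₄(ℚ̄_p)` irreducible and, for every
`n`, an approximant `r'` with `‖tr r' - tr ρ‖_∞ ≤ p⁻ⁿ` which is automorphic (`Aut r'`) OR endoscopic
(`Endo r'`: `tr r' = tr r₁ + tr r₂` for continuous `r₁, r₂ : Γ_ℚ → GL₂(ℚ̄_p)`).  The first step of
its intended proof removes the endoscopic alternative.  Proved here, sorry-free:

* `charpoly_eq_mul_of_trace_eq_add` — an endoscopic trace identity `tr r = tr r₁ + tr r₂`
  (characteristic `0`) is a characteristic-polynomial identity `det(X - r) = det(X - r₁) det(X - r₂)`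
  (Newton, file I, against the block sum `r₁ ⊕ r₂`, tree `exists_blockDiag_hom`);
* `not_isIrreducible_of_trace_eq_add` — **an endoscopic representation is reducible**: Brauer–Nesbitt
  in characteristic `0` (tree `Representation.nonempty_equiv_of_character_eq_of_isSemisimple`)
  against the semisimplified block sum (tree `exists_semisimplification`), whose first block is a
  proper non-zero subrepresentation; `not_isIrreducible_of_endo`, `charpoly_eq_mul_of_endo` — the
  same in the exact vocabulary of Stub 4 (`FramedGaloisRep ℚ (PadicAlgCl p) 4`, clause `Endo`);
* `aut_approximants_or_endo_approximants` — the Aut/Endo DICHOTOMY of the pro-automorphy hypothesis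
  (pigeonhole: the closeness clause is antitone in `n`): automorphic approximants exist to every
  precision, or endoscopic ones do;
* `aut_approximants_of_limit_endo` — **endo-removal modulo the limit lemma**: granted the one
  genuinely missing statement "endoscopic approximants to every precision ⟹ `ρ` endoscopic" (a
  uniform `p`-adic limit of endoscopic traces at a residually multiplicity-free point is endoscopic;
  to be proved with Taylor's pseudocharacter theorem, tree
  `exists_semisimple_rep_of_isPseudocharacter`), the hypothesis of Stub 4 improves to AUTOMORPHIC
  approximants at every precision, since an endoscopic irreducible `ρ` is absurd.  What then remains
  of Stub 4 is classicality of `p`-adic limits of automorphic ordinary traces in weight `(2,2)`.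

References: Bourbaki, *Algèbre* VIII § 20 n° 6 (Brauer–Nesbitt); Taylor, Duke Math. J. 63 (1991)
§1 (pseudo-representations); Deligne–Serre, ASENS 7 (1974) 6.12 (semisimplification).
-/

noncomputable section

open Polynomial Finset
open scoped Matrix

namespace Summit.Langlands.Langlands.Cruxes.ResiduallyYoshidaLifting.EndoscopicCrossingEuler

set_option linter.dupNamespace false

/-! ### Endoscopic trace identities: characteristic polynomials and reducibility -/

section Representations

open Literature.RepresentationTheory.Semisimple

/-- Trace is invariant under reindexing. [folklore] -/
private theorem trace_reindex {m m' S : Type*} [Fintype m] [Fintype m'] [AddCommMonoid S]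
    (e : m ≃ m') (M : Matrix m m S) : (Matrix.reindex e e M).trace = M.trace := by
  simp only [Matrix.trace, Matrix.reindex_apply, Matrix.diag_apply, Matrix.submatrix_apply]
  exact e.symm.sum_comp (fun j => M j j)

/-- The trace of a block matrix is the sum of the traces of its diagonal blocks. [folklore] -/
private theorem trace_fromBlocks {m m' S : Type*} [Fintype m] [Fintype m'] [AddCommMonoid S]
    (A : Matrix m m S) (B : Matrix m m' S) (C : Matrix m' m S) (D : Matrix m' m' S) :
    (Matrix.fromBlocks A B C D).trace = A.trace + D.trace := by
  simp [Matrix.trace, Fintype.sum_sum_type]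

/-- **An endoscopic trace identity is a characteristic-polynomial identity.**  If
`tr r(g) = tr r₁(g) + tr r₂(g)` for all `g` (`r : G → GL_n(K)`, `rᵢ : G → GL_{aᵢ}(K)`, `a₁ + a₂ = n`,
`K` a field of characteristic `0`), then `det(X - r(g)) = det(X - r₁(g)) · det(X - r₂(g))` for all
`g` (compare `r` with the block-diagonal sum `r₁ ⊕ r₂`, tree `exists_blockDiag_hom`). [folklore] -/
theorem charpoly_eq_mul_of_trace_eq_add {G : Type*} [Group G] {K : Type*} [Field K] [CharZero K]
    {n a b : ℕ} (e : Fin a ⊕ Fin b ≃ Fin n) (r : G →* GL (Fin n) K) (r₁ : G →* GL (Fin a) K)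
    (r₂ : G →* GL (Fin b) K)
    (h : ∀ g, ((r g : GL (Fin n) K) : Matrix (Fin n) (Fin n) K).trace =
      ((r₁ g : GL (Fin a) K) : Matrix (Fin a) (Fin a) K).trace +
        ((r₂ g : GL (Fin b) K) : Matrix (Fin b) (Fin b) K).trace) (g : G) :
    ((r g : GL (Fin n) K) : Matrix (Fin n) (Fin n) K).charpoly =
      ((r₁ g : GL (Fin a) K) : Matrix (Fin a) (Fin a) K).charpoly *
        ((r₂ g : GL (Fin b) K) : Matrix (Fin b) (Fin b) K).charpoly := by
  obtain ⟨R, hR⟩ := exists_blockDiag_hom (k := K) e r₁ r₂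
  have htr : ∀ g, ((r g : GL (Fin n) K) : Matrix (Fin n) (Fin n) K).trace =
      ((R g : GL (Fin n) K) : Matrix (Fin n) (Fin n) K).trace := fun g => by
    rw [hR g, trace_reindex, trace_fromBlocks, h g]
  rw [charpoly_eq_of_trace_eq R r htr g, hR g, Matrix.charpoly_reindex,
    Matrix.charpoly_fromBlocks_zero₁₂]

/-- The linear map `v ↦ ψ(g) v` of the representation on `Kⁿ` through `ψ : G → GL_n(K)` is
`Matrix.toLin'` of the matrix `ψ(g)`. [folklore] -/
private theorem rep_apply_eq_toLin' {G : Type*} [Group G] {K : Type*} [Field K] {n : ℕ}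
    (ψ : G →* GL (Fin n) K) (g : G) :
    (((Representation.ofDistribMulAction K (GL (Fin n) K) (Fin n → K)).comp ψ) g :
        (Fin n → K) →ₗ[K] (Fin n → K)) =
      Matrix.toLin' ((ψ g : GL (Fin n) K) : Matrix (Fin n) (Fin n) K) :=
  LinearMap.ext fun v ↦ by rw [Matrix.toLin'_apply]; rfl

/-- **An endoscopic representation is reducible.**  Over a field of characteristic `0`: if the
trace of `r : G → GL_n(K)` is the sum of the traces of `r₁ : G → GL_a(K)` and `r₂ : G → GL_b(K)`
with `a, b ≥ 1`, `a + b = n`, then the representation of `G` on `Kⁿ` through `r` is NOT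
irreducible.  Proof: were it irreducible it would be semisimple with the character of the
semisimple block sum `r₁ˢˢ ⊕ r₂ˢˢ` (tree `exists_semisimplification`, `exists_blockDiag_hom`),
hence equivalent to it (Brauer–Nesbitt in characteristic `0`, tree
`Representation.nonempty_equiv_of_character_eq_of_isSemisimple`); but the block sum has the
proper non-zero subrepresentation `Kᵃ ⊕ 0`. [folklore] -/
theorem not_isIrreducible_of_trace_eq_add {G : Type*} [Group G] {K : Type*} [Field K] [CharZero K]
    {n a b : ℕ} (e : Fin a ⊕ Fin b ≃ Fin n) (ha : 0 < a) (hb : 0 < b) (r : G →* GL (Fin n) K)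
    (r₁ : G →* GL (Fin a) K) (r₂ : G →* GL (Fin b) K)
    (h : ∀ g, ((r g : GL (Fin n) K) : Matrix (Fin n) (Fin n) K).trace =
      ((r₁ g : GL (Fin a) K) : Matrix (Fin a) (Fin a) K).trace +
        ((r₂ g : GL (Fin b) K) : Matrix (Fin b) (Fin b) K).trace) :
    ¬ Representation.IsIrreducible
      ((Representation.ofDistribMulAction K (GL (Fin n) K) (Fin n → K)).comp r) := by
  intro hirr
  haveI : Nonempty (Fin a) := ⟨⟨0, ha⟩⟩
  haveI : Nonempty (Fin b) := ⟨⟨0, hb⟩⟩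
  -- semisimplify the blocks and form the (semisimple) block-diagonal sum `R = r₁ˢˢ ⊕ r₂ˢˢ`
  obtain ⟨r₁', h₁ss, h₁cp, -⟩ := exists_semisimplification r₁
  obtain ⟨r₂', h₂ss, h₂cp, -⟩ := exists_semisimplification r₂
  obtain ⟨R, hR⟩ := exists_blockDiag_hom (k := K) e r₁' r₂'
  set ρ : Representation K G (Fin n → K) :=
    (Representation.ofDistribMulAction K (GL (Fin n) K) (Fin n → K)).comp r with hρ
  set ρR : Representation K G (Fin n → K) :=
    (Representation.ofDistribMulAction K (GL (Fin n) K) (Fin n → K)).comp R with hρR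
  haveI : ρ.IsIrreducible := hirr
  haveI : ρ.IsSemisimpleRepresentation :=
    (inferInstance : ComplementedLattice (Subrepresentation ρ))
  haveI : ρR.IsSemisimpleRepresentation := isSemisimpleRepresentation_of_blockDiag e hR h₁ss h₂ss
  -- the characters agree
  have hchar : ρ.character = ρR.character := by
    funext g
    change LinearMap.trace K _ (ρ g) = LinearMap.trace K _ (ρR g)
    rw [hρ, hρR, rep_apply_eq_toLin', rep_apply_eq_toLin', Matrix.trace_toLin'_eq,
      Matrix.trace_toLin'_eq, hR g, trace_reindex, trace_fromBlocks, h g,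
      Matrix.trace_eq_neg_charpoly_coeff ((r₁' g : GL (Fin a) K) : Matrix (Fin a) (Fin a) K),
      Matrix.trace_eq_neg_charpoly_coeff ((r₁ g : GL (Fin a) K) : Matrix (Fin a) (Fin a) K),
      Matrix.trace_eq_neg_charpoly_coeff ((r₂' g : GL (Fin b) K) : Matrix (Fin b) (Fin b) K),
      Matrix.trace_eq_neg_charpoly_coeff ((r₂ g : GL (Fin b) K) : Matrix (Fin b) (Fin b) K),
      h₁cp g, h₂cp g]
  -- Brauer–Nesbitt in characteristic zero: `ρ ≃ ρR`, so `ρR` is irreducible as well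
  obtain ⟨φ⟩ := Representation.nonempty_equiv_of_character_eq_of_isSemisimple ρ ρR hchar
  haveI : ρR.IsIrreducible := Representation.isIrreducible_of_equiv φ
  -- but the first block `{v | v vanishes on the second block}` is a proper non-zero subrepresentation
  let W : Subrepresentation ρR :=
    { toSubmodule :=
        { carrier := {v | ∀ j : Fin b, v (e (Sum.inr j)) = 0}
          add_mem' := fun {v w} hv hw j => by simp [hv j, hw j]
          zero_mem' := fun j => rfl
          smul_mem' := fun c {v} hv j => by simp [hv j] }
      apply_mem_toSubmodule := fun g {v} hv j => by
        change ((((R g : GL (Fin n) K) : Matrix (Fin n) (Fin n) K)) *ᵥ v) (e (Sum.inr j)) = 0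
        have hv' : (v ∘ ⇑e) ∘ Sum.inr = 0 := funext hv
        rw [hR g, Matrix.reindex_apply, Matrix.submatrix_mulVec_equiv, Function.comp_apply,
          Equiv.symm_apply_apply, Equiv.symm_symm, Matrix.fromBlocks_mulVec, Sum.elim_inr, hv',
          Matrix.zero_mulVec, Matrix.mulVec_zero, add_zero, Pi.zero_apply] }
  rcases IsSimpleOrder.eq_bot_or_eq_top W with hW | hW
  · -- `W = ⊥`: but the basis vector at `e (inl 0)` lies in `W`
    have hmem : (Pi.single (e (Sum.inl ⟨0, ha⟩)) (1 : K) : Fin n → K) ∈ W := by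
      intro j
      rw [Pi.single_apply, if_neg fun hj => Sum.inr_ne_inl (e.injective hj)]
    rw [hW] at hmem
    change (Pi.single (e (Sum.inl ⟨0, ha⟩)) (1 : K) : Fin n → K) ∈ (⊥ : Submodule K (Fin n → K))
      at hmem
    rw [Submodule.mem_bot] at hmem
    simpa using congrFun hmem (e (Sum.inl ⟨0, ha⟩))
  · -- `W = ⊤`: but the basis vector at `e (inr 0)` does not lie in `W`
    have hmem : (Pi.single (e (Sum.inr ⟨0, hb⟩)) (1 : K) : Fin n → K) ∈ W := by
      rw [hW]
      change (Pi.single (e (Sum.inr ⟨0, hb⟩)) (1 : K) : Fin n → K) ∈ (⊤ : Submodule K (Fin n → K))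
      exact Submodule.mem_top
    simpa using hmem ⟨0, hb⟩

end Representations


/-! ### Over `ℚ̄_p`, in the vocabulary of Stub 4 -/

section Padic

open Literature.NumberTheory.GaloisRepresentations

variable {p : ℕ} [Fact p.Prime]

/-- **An endoscopic `Γ_ℚ`-representation is reducible**: if `tr ρ = tr r₁ + tr r₂` on `Γ_ℚ` for
continuous `ρ : Γ_ℚ → GL₄(ℚ̄_p)` and `r₁, r₂ : Γ_ℚ → GL₂(ℚ̄_p)` (the clause `Endo ρ` of Stub 4 of the
line `endoscopic-crossing-euler`), then `ρ` is not irreducible.  This is the last step of the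
ENDO-REMOVAL argument for Stub 4 (`stub_weightTwoClassicality`): a `p`-adic limit of endoscopic
traces which is itself endoscopic contradicts the irreducibility hypothesis on `ρ`. [folklore] -/
theorem not_isIrreducible_of_endo (ρ : FramedGaloisRep ℚ (PadicAlgCl p) 4)
    (h : ∃ r₁ r₂ : FramedGaloisRep ℚ (PadicAlgCl p) 2,
      ∀ g, (ρ g).val.trace = (r₁ g).val.trace + (r₂ g).val.trace) :
    ¬ ρ.toGaloisRep.IsIrreducible := by
  obtain ⟨r₁, r₂, h⟩ := h
  have key : ¬ Representation.IsIrreducible ((Representation.ofDistribMulAction (PadicAlgCl p)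
      (GL (Fin 4) (PadicAlgCl p)) (Fin 4 → PadicAlgCl p)).comp ρ.toMonoidHom) :=
    not_isIrreducible_of_trace_eq_add (K := PadicAlgCl p) (n := 4) (a := 2) (b := 2)
      finSumFinEquiv two_pos two_pos ρ.toMonoidHom r₁.toMonoidHom r₂.toMonoidHom h
  exact key

/-- **Endoscopic traces have split characteristic polynomials**: under `Endo ρ`,
`det(X - ρ(g)) = det(X - r₁(g)) · det(X - r₂(g))` for every `g ∈ Γ_ℚ`. [folklore] -/
theorem charpoly_eq_mul_of_endo (ρ : FramedGaloisRep ℚ (PadicAlgCl p) 4)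
    (r₁ r₂ : FramedGaloisRep ℚ (PadicAlgCl p) 2)
    (h : ∀ g, (ρ g).val.trace = (r₁ g).val.trace + (r₂ g).val.trace) (g : Field.absoluteGaloisGroup ℚ) :
    (ρ g).val.charpoly = (r₁ g).val.charpoly * (r₂ g).val.charpoly :=
  charpoly_eq_mul_of_trace_eq_add (n := 4) (a := 2) (b := 2) finSumFinEquiv ρ.toMonoidHom
    r₁.toMonoidHom r₂.toMonoidHom h g

end Padic


/-! ### The Aut/Endo dichotomy of a pro-automorphy hypothesis, and endo-removal modulo the limit lemma -/

section Dichotomy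

/-- **Pigeonhole for approximants.**  If for every `n` there is an approximant `x` of quality `n`
(`C n x`, antitone in `n`) which is of kind `A` or of kind `E` (and satisfies `L`), then either
every quality is achieved by approximants of kind `A`, or every quality is achieved by approximants
of kind `E`. [folklore] -/
theorem forall_exists_or_forall_exists_of_antitone {α : Type*} {A E L : α → Prop} {C : ℕ → α → Prop}
    (hC : ∀ m n x, m ≤ n → C n x → C m x) (h : ∀ n, ∃ x, (A x ∨ E x) ∧ L x ∧ C n x) :
    (∀ n, ∃ x, A x ∧ L x ∧ C n x) ∨ (∀ n, ∃ x, E x ∧ L x ∧ C n x) := by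
  by_contra hne
  push Not at hne
  obtain ⟨⟨n₁, h₁⟩, ⟨n₂, h₂⟩⟩ := hne
  obtain ⟨x, hAE | hAE, hL, hCx⟩ := h (max n₁ n₂)
  · exact h₁ x hAE hL (hC _ _ x (le_max_left _ _) hCx)
  · exact h₂ x hAE hL (hC _ _ x (le_max_right _ _) hCx)

open Literature.NumberTheory.GaloisRepresentations

variable {p : ℕ} [Fact p.Prime]

/-- `p⁻ⁿ ≤ p⁻ᵐ` for `m ≤ n`: the trace-closeness clause of Stub 4 is antitone in the level `n`.
[folklore] -/
theorem zpow_neg_natCast_antitone {m n : ℕ} (hmn : m ≤ n) :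
    (p : ℝ) ^ (-(n : ℤ)) ≤ (p : ℝ) ^ (-(m : ℤ)) :=
  zpow_le_zpow_right₀ (by exact_mod_cast (Fact.out : p.Prime).one_lt.le)
    (neg_le_neg (by exact_mod_cast hmn))

/-- **The Aut/Endo dichotomy of the pro-automorphy hypothesis of Stub 4.**  In the hypothesis of
`stub_weightTwoClassicality` — for every `n` an approximant `r'` of `ρ` to trace-precision `p⁻ⁿ`
which is automorphic (`Aut r'`, any predicate) OR endoscopic, and of level/ordinarity type
`OrdLevel r'` (any predicate) — either automorphic approximants exist to every precision, or
endoscopic ones do. [folklore] -/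
theorem aut_approximants_or_endo_approximants
    (Aut OrdLevel : FramedGaloisRep ℚ (PadicAlgCl p) 4 → Prop) (ρ : FramedGaloisRep ℚ (PadicAlgCl p) 4)
    (h : ∀ n : ℕ, ∃ r' : FramedGaloisRep ℚ (PadicAlgCl p) 4,
      (Aut r' ∨ ∃ r₁ r₂ : FramedGaloisRep ℚ (PadicAlgCl p) 2,
          ∀ g, (r' g).val.trace = (r₁ g).val.trace + (r₂ g).val.trace) ∧ OrdLevel r' ∧
        ∀ g, ‖(r' g).val.trace - (ρ g).val.trace‖ ≤ (p : ℝ) ^ (-(n : ℤ))) :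
    (∀ n : ℕ, ∃ r' : FramedGaloisRep ℚ (PadicAlgCl p) 4, Aut r' ∧ OrdLevel r' ∧
        ∀ g, ‖(r' g).val.trace - (ρ g).val.trace‖ ≤ (p : ℝ) ^ (-(n : ℤ))) ∨
      (∀ n : ℕ, ∃ r' : FramedGaloisRep ℚ (PadicAlgCl p) 4,
        (∃ r₁ r₂ : FramedGaloisRep ℚ (PadicAlgCl p) 2,
          ∀ g, (r' g).val.trace = (r₁ g).val.trace + (r₂ g).val.trace) ∧ OrdLevel r' ∧
        ∀ g, ‖(r' g).val.trace - (ρ g).val.trace‖ ≤ (p : ℝ) ^ (-(n : ℤ))) :=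
  forall_exists_or_forall_exists_of_antitone
    (C := fun n (r' : FramedGaloisRep ℚ (PadicAlgCl p) 4) =>
      ∀ g, ‖(r' g).val.trace - (ρ g).val.trace‖ ≤ (p : ℝ) ^ (-(n : ℤ)))
    (fun _ _ _ hmn hx g => (hx g).trans (zpow_neg_natCast_antitone hmn)) h

/-- **Endo-removal for Stub 4, modulo the limit lemma.**  Let `ρ : Γ_ℚ → GL₄(ℚ̄_p)` be
irreducible and ordinarily pro-automorphic in the sense of `stub_weightTwoClassicality` (for every
`n` an automorphic-OR-endoscopic approximant of type `OrdLevel` to trace-precision `p⁻ⁿ`).  ASSUME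
the limit lemma `hlim`: if endoscopic approximants of type `OrdLevel` exist to every precision then
`ρ` itself is endoscopic ("a uniform `p`-adic limit of endoscopic traces at a residually
multiplicity-free point is endoscopic" — the genuinely missing step, to be supplied with Taylor's
pseudocharacter theorem).  Then AUTOMORPHIC approximants exist to every precision: by the dichotomy,
the alternative would make `ρ` endoscopic, hence reducible (`not_isIrreducible_of_endo`).  So Stub 4
reduces to `hlim` plus classicality of `p`-adic limits of AUTOMORPHIC ordinary traces. [folklore] -/
theorem aut_approximants_of_limit_endo
    (Aut OrdLevel : FramedGaloisRep ℚ (PadicAlgCl p) 4 → Prop) (ρ : FramedGaloisRep ℚ (PadicAlgCl p) 4)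
    (hirr : ρ.toGaloisRep.IsIrreducible)
    (hlim : (∀ n : ℕ, ∃ r' : FramedGaloisRep ℚ (PadicAlgCl p) 4,
        (∃ r₁ r₂ : FramedGaloisRep ℚ (PadicAlgCl p) 2,
          ∀ g, (r' g).val.trace = (r₁ g).val.trace + (r₂ g).val.trace) ∧ OrdLevel r' ∧
        ∀ g, ‖(r' g).val.trace - (ρ g).val.trace‖ ≤ (p : ℝ) ^ (-(n : ℤ))) →
      ∃ r₁ r₂ : FramedGaloisRep ℚ (PadicAlgCl p) 2,
        ∀ g, (ρ g).val.trace = (r₁ g).val.trace + (r₂ g).val.trace)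
    (h : ∀ n : ℕ, ∃ r' : FramedGaloisRep ℚ (PadicAlgCl p) 4,
      (Aut r' ∨ ∃ r₁ r₂ : FramedGaloisRep ℚ (PadicAlgCl p) 2,
          ∀ g, (r' g).val.trace = (r₁ g).val.trace + (r₂ g).val.trace) ∧ OrdLevel r' ∧
        ∀ g, ‖(r' g).val.trace - (ρ g).val.trace‖ ≤ (p : ℝ) ^ (-(n : ℤ))) :
    ∀ n : ℕ, ∃ r' : FramedGaloisRep ℚ (PadicAlgCl p) 4, Aut r' ∧ OrdLevel r' ∧
      ∀ g, ‖(r' g).val.trace - (ρ g).val.trace‖ ≤ (p : ℝ) ^ (-(n : ℤ)) := by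
  rcases aut_approximants_or_endo_approximants Aut OrdLevel ρ h with hA | hE
  · exact hA
  · exact absurd hirr (not_isIrreducible_of_endo ρ (hlim hE))

/-- **Registered sub-goal `stub_endoRemovalModuloLimit` of Stub 4** (the statement through which
this helper file lands, `--supports stmt-Langlands-13639`; = `aut_approximants_of_limit_endo` in
closed form): for `ρ : Γ_ℚ → GL₄(ℚ̄_p)` irreducible, ANY predicates `Aut`, `OrdLevel`, and the
pro-automorphy hypothesis of `stub_weightTwoClassicality` (automorphic-or-endoscopic approximants of
type `OrdLevel` to every trace-precision `p⁻ⁿ`), IF endoscopic approximants to every precision force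
`ρ` to be endoscopic (the limit lemma, taken as a hypothesis), THEN automorphic approximants exist to
every precision. [folklore] -/
theorem stub_endoRemovalModuloLimit :
    ∀ (p : ℕ) [Fact p.Prime]
      (Aut OrdLevel : Literature.NumberTheory.GaloisRepresentations.FramedGaloisRep ℚ (PadicAlgCl p) 4 → Prop)
      (ρ : Literature.NumberTheory.GaloisRepresentations.FramedGaloisRep ℚ (PadicAlgCl p) 4),
      ρ.toGaloisRep.IsIrreducible →
      ((∀ n : ℕ, ∃ r' : Literature.NumberTheory.GaloisRepresentations.FramedGaloisRep ℚ (PadicAlgCl p) 4,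
          (∃ r₁ r₂ : Literature.NumberTheory.GaloisRepresentations.FramedGaloisRep ℚ (PadicAlgCl p) 2,
            ∀ g, (r' g).val.trace = (r₁ g).val.trace + (r₂ g).val.trace) ∧ OrdLevel r' ∧
          ∀ g, ‖(r' g).val.trace - (ρ g).val.trace‖ ≤ (p : ℝ) ^ (-(n : ℤ))) →
        ∃ r₁ r₂ : Literature.NumberTheory.GaloisRepresentations.FramedGaloisRep ℚ (PadicAlgCl p) 2,
          ∀ g, (ρ g).val.trace = (r₁ g).val.trace + (r₂ g).val.trace) →
      (∀ n : ℕ, ∃ r' : Literature.NumberTheory.GaloisRepresentations.FramedGaloisRep ℚ (PadicAlgCl p) 4,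
        (Aut r' ∨ ∃ r₁ r₂ : Literature.NumberTheory.GaloisRepresentations.FramedGaloisRep ℚ (PadicAlgCl p) 2,
            ∀ g, (r' g).val.trace = (r₁ g).val.trace + (r₂ g).val.trace) ∧ OrdLevel r' ∧
          ∀ g, ‖(r' g).val.trace - (ρ g).val.trace‖ ≤ (p : ℝ) ^ (-(n : ℤ))) →
      ∀ n : ℕ, ∃ r' : Literature.NumberTheory.GaloisRepresentations.FramedGaloisRep ℚ (PadicAlgCl p) 4,
        Aut r' ∧ OrdLevel r' ∧ ∀ g, ‖(r' g).val.trace - (ρ g).val.trace‖ ≤ (p : ℝ) ^ (-(n : ℤ)) :=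
  fun _ _ Aut OrdLevel ρ hirr hlim h => aut_approximants_of_limit_endo Aut OrdLevel ρ hirr hlim h

end Dichotomy

end Summit.Langlands.Langlands.Cruxes.ResiduallyYoshidaLifting.EndoscopicCrossingEuler

end
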